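import Summits.QuantumFields.YangMills.Theorems.BalabanUVNodesSpineRatesHolder

/-!
# BalabanUVNodes ∕ N19 — K4's RATES SHRINK TO THE TUNING WINDOW: `RatesHolderAt D R β` (and `RatesAt`, and the (D4) read-out `ReadOutAt D R.u3`) at node U3's carriers
# with window `R.u3.W ⊇ Window γt` and radius `R.u3.γ ≥ γt` IMPLY the same at the SHRUNK carriers `⟨R.u3.C, Window γt, γt, …⟩` — every U3-side node statement is a
# `∀ g ∈ W` ∕ `∀ v ∈ Box γ` statement (monotone under restriction)

Cell `pub-ymgap`, HUMAN RULING D-0062 (Track A) + D-0149 (work-bound push, director-ym №197), WIDTH SEAT `pub-ymgap-dag-n19-w3` (N19 NE7, seat 3 of 3), generation g2;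
bus INTENT-9.  Cluster item K3⁷ «SpineGivenEndpointR13SepCoPH» (stmt-QuantumFields-20544); filed `--kind proof --supports` that item `--as helper` (it proves no registered
stub).  COUNT-NEUTRAL.  THEOREMS ONLY; 0 `def` (the shrunk carriers are written as a STRUCTURE LITERAL `⟨u.C, Window γt, γt, u.κ, u.EA, u.EB, u.θ, u.C₅, u.Λ, u.C₉, u.ω,
u.cr, u.ρ⟩`; no new name); 0 `sorry`; NO Theses import.  Imports dag-n16-e's `…SpineRatesHolder` (p573254: `RatesHolderAt`; brings `…SpineRates`: `U3Carriers`, `N17At`,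
`N18At`, `N22At`, `ReadOutAt`, `RatesAt`) — CITED BY NAME, none edited.

WHY (this seat's programme, INTENT-10).  Under the `ForSmallCouplings` prefix the runs of record of a bare sequence tuned within `]0, γ]`, `γ ≤ θ.γ`, live in the γ-box; the
N19′ link reading's window-quantified NODE-O clauses ((T)'s `DecayBound` and pair discs `∀ s ∈ R.u3.W`, the selector clause, (T)'s window smallness `∀ s ∈ R.u3.W, ∀ j,
s j² ≤ e⁻¹` — whence J's tuple letter `θ.γ² ≤ e⁻¹`) are then only NEEDED on `Window γ ⊆ Window θ.γ = R.u3.W`, provided K4's rates, which the slot supplies at the record's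
carriers, DESCEND to the shrunk carriers.  They do (this file), because N17 (`ScaleShiftRate` on the γ-boxes), N18 (`NE5`, `∀ g ∈ W`), N22 (`NE9`, `∀ g g' ∈ W`; fading
memory window-free), and every clause of the (D4) read-out (`RepresentsA∕B` on the boxes, the slice memberships `∀ g ∈ W`, the box-extension clause) restrict; N14 ∕ N15 ∕ N16
do not read node U3's carriers.  So INTENT-10 runs E′ at the shrunk bundle and `θ.γ² ≤ e⁻¹` becomes `γ² ≤ e⁻¹` — a threshold of the prefix, discharged.

WHAT THIS FILE PROVES (for `u : U3Carriers`, `0 < γt`, `γt ≤ u.γ`, `Window γt ⊆ u.W`; the shrunk carriers `u↓γt := ⟨u.C, Window γt, γt, u.κ, u.EA, u.EB, u.θ, u.C₅, u.Λ,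
u.C₉, u.ω, u.cr, u.ρ⟩` written out).
* §1 `window_mono` (`Window γt ⊆ Window γ` for `γt ≤ γ`; the box-extension clause holds at every radius by the tree's `T4BetaReadOut.extd_mem_window`) ·
  `n17At_shrink` · `n18At_shrink` · `n22At_shrink` · `readOutAt_shrink` — each U3-side node statement ∕ the (D4) read-out descends to `u↓γt`. [folklore]
* §2 `ratesHolderAt_shrink` · `ratesAt_shrink` — K4's conclusion in the R-β currency (and at `β = 1`) descends from `R` to `⟨R.ne1, R.ne2, R.ne3, R.u3↓γt⟩`;
  `ratesHolderAt_shrink_window` — the record's case `u.W = Window u.γ` (node U3's bundle of record: `u3OfRecord₁₃_W`), where `Window γt ⊆ u.W` is `window_mono`.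

HONEST FRAMING.  Count-neutral kernel bookkeeping (restriction of `∀`-statements); NE4 ∕ NE5 ∕ NE9 ∕ (D4) ∕ NE1′ ∕ NE2 ∕ NE3 are HYPOTHESES by name, asserted for no
bundle; nothing of Bałaban's is asserted or instantiated (K0⁷ OPEN); N19 NOT discharged; K3⁷ NOT claimed; Track A count unmoved (typed 28∕28 · discharged 5∕27 · A 5∕28).  One
finite four-torus at fixed ε, rung (B)+1 — R4 closes the CONDITIONAL finite-𝕋⁴ rung `BalabanLadder.UV` only; NOT infinite volume, NOT OS on ℝ⁴, NOT a mass gap; the YM mass gap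
(Clay) is NOT proved by any of this.  Standard axioms.  Supersedes nothing; edits nothing.  No decl below carries a cite tag.
-/

set_option autoImplicit false

noncomputable section

namespace Summit.QuantumFields.YangMills.BalabanUVNodes.N19RatesAtTuningWindow

open Literature.MathematicalPhysics.QuantumFieldTheory.Balaban1983to89
open Literature.MathematicalPhysics.QuantumFieldTheory.Balaban1983to89.T4Continuum (T4Family)
open T4OutputRate (Window mem_window NE5 NE9)
open T4BetaReadOut (RepresentsA RepresentsB extd_mem_window)
open T4FlagMemory (extd)
open FlowStep (Box mem_box box_mono)
open YMDAG.UVSplit (Datum U3Carriers RateCarriers N14At N15At N16At N17At N18At N22At ReadOutAt RatesAt)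
open Summit.QuantumFields.YangMills.BalabanUVNodes.N16HolderDefs (N16HolderAt)
open Summit.QuantumFields.YangMills.BalabanUVNodes.SpineRatesHolder (RatesHolderAt)

/-! ## §1 Node U3's statements descend to the shrunk carriers -/

section U3

variable {F : T4Family} {N : ℕ} [NeZero N]

/-- Windows are monotone in the radius. [folklore] -/
theorem window_mono {γt γ : ℝ} (h : γt ≤ γ) : Window γt ⊆ Window γ := fun _ hg i => ⟨(hg i).1, (hg i).2.trans h⟩

/-- **N17 DESCENDS** (NE4 = `ScaleShiftRate` on the γ-boxes; `FlowStep.box_mono`). [folklore] -/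
theorem n17At_shrink (D : Datum F N) (u : U3Carriers) {γt : ℝ} (hγ : γt ≤ u.γ) (h : N17At D u) :
    N17At D ⟨u.C, Window γt, γt, u.κ, u.EA, u.EB, u.θ, u.C₅, u.Λ, u.C₉, u.ω, u.cr, u.ρ⟩ :=
  fun k w hw => h k w (box_mono hγ (k + 1) hw)

/-- **N18 DESCENDS** (NE5 is `∀ g ∈ W`; run B's first couplings `b ≤ γt ≤ u.γ`). [folklore] -/
theorem n18At_shrink (u : U3Carriers) {γt : ℝ} (hγ : γt ≤ u.γ) (hW : Window γt ⊆ u.W) (h : N18At u) :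
    N18At ⟨u.C, Window γt, γt, u.κ, u.EA, u.EB, u.θ, u.C₅, u.Λ, u.C₉, u.ω, u.cr, u.ρ⟩ :=
  fun b hb hbγ g hg U X => h b hb (hbγ.trans hγ) g (hW hg) U X

/-- **N22 DESCENDS** (NE9 is `∀ g g' ∈ W`; the fading memory of the moduli does not read the window). [folklore] -/
theorem n22At_shrink (u : U3Carriers) {γt : ℝ} (hW : Window γt ⊆ u.W) (h : N22At u) :
    N22At ⟨u.C, Window γt, γt, u.κ, u.EA, u.EB, u.θ, u.C₅, u.Λ, u.C₉, u.ω, u.cr, u.ρ⟩ :=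
  ⟨fun g hg g' hg' U X => h.1 g (hW hg) g' (hW hg') U X, h.2⟩

/-- **THE (D4) READ-OUT DESCENDS**: the box-extension clause holds at every radius (`T4BetaReadOut.extd_mem_window`); `RepresentsA∕B` restrict to the smaller boxes; the slice
memberships restrict to the smaller window; the recipe bounds and the letter signs do not read the window. [folklore] -/
theorem readOutAt_shrink (D : Datum F N) (u : U3Carriers) {γt : ℝ} (hγ : γt ≤ u.γ) (hW : Window γt ⊆ u.W) (h : ReadOutAt D u) :
    ReadOutAt D ⟨u.C, Window γt, γt, u.κ, u.EA, u.EB, u.θ, u.C₅, u.Λ, u.C₉, u.ω, u.cr, u.ρ⟩ := by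
  obtain ⟨𝒜A, 𝒜B, rA, rB, -, hA, hB, h𝒜A, h𝒜B, hr, hcov, hcr, hC₅, hθ, hω, hθρ, hωρ⟩ := h
  exact ⟨𝒜A, 𝒜B, rA, rB, fun k v hv => extd_mem_window hv, fun k v hv => hA k v (box_mono hγ k hv),
    fun k w hw => hB k w (box_mono hγ (k + 1) hw), fun g hg => h𝒜A g (hW hg), fun b hb hbγ g hg => h𝒜B b hb (hbγ.trans hγ) g (hW hg),
    hr, hcov, hcr, hC₅, hθ, hω, hθρ, hωρ⟩

end U3

/-! ## §2 K4's conclusion descends from the carriers of record to the carriers at the tuning window -/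

section Rates

variable {F : T4Family} {N : ℕ} [NeZero N]

/-- **`RatesHolderAt D R β` DESCENDS TO THE SHRUNK CARRIERS** `⟨R.ne1, R.ne2, R.ne3, R.u3↓γt⟩` (`γt ≤ R.u3.γ`, `Window γt ⊆ R.u3.W`): N14 ∕ N15 ∕ N16's β-root untouched,
N17 ∕ N18 ∕ N22 by §1. [folklore] -/
theorem ratesHolderAt_shrink (D : Datum F N) (R : RateCarriers N) (β : ℝ) {γt : ℝ} (hγ : γt ≤ R.u3.γ) (hW : Window γt ⊆ R.u3.W)
    (h : RatesHolderAt D R β) :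
    RatesHolderAt D ⟨R.ne1, R.ne2, R.ne3,
      ⟨R.u3.C, Window γt, γt, R.u3.κ, R.u3.EA, R.u3.EB, R.u3.θ, R.u3.C₅, R.u3.Λ, R.u3.C₉, R.u3.ω, R.u3.cr, R.u3.ρ⟩⟩ β :=
  ⟨h.1, h.2.1, h.2.2.1, n17At_shrink D R.u3 hγ h.2.2.2.1, n18At_shrink R.u3 hγ hW h.2.2.2.2.1, n22At_shrink R.u3 hW h.2.2.2.2.2⟩

/-- The same at `β = 1`'s currency `RatesAt D R` (N16's slot `N16At` untouched). [folklore] -/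
theorem ratesAt_shrink (D : Datum F N) (R : RateCarriers N) {γt : ℝ} (hγ : γt ≤ R.u3.γ) (hW : Window γt ⊆ R.u3.W) (h : RatesAt D R) :
    RatesAt D ⟨R.ne1, R.ne2, R.ne3,
      ⟨R.u3.C, Window γt, γt, R.u3.κ, R.u3.EA, R.u3.EB, R.u3.θ, R.u3.C₅, R.u3.Λ, R.u3.C₉, R.u3.ω, R.u3.cr, R.u3.ρ⟩⟩ :=
  ⟨h.1, h.2.1, h.2.2.1, n17At_shrink D R.u3 hγ h.2.2.2.1, n18At_shrink R.u3 hγ hW h.2.2.2.2.1, n22At_shrink R.u3 hW h.2.2.2.2.2⟩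

/-- **THE RECORD's CASE**: when the carriers' window IS `Window R.u3.γ` (node U3's bundle of record, `u3OfRecord₁₃_W`), every smaller radius `γt ≤ R.u3.γ` is admissible
(`window_mono`). [folklore] -/
theorem ratesHolderAt_shrink_window (D : Datum F N) (R : RateCarriers N) (β : ℝ) {γt : ℝ} (hγ : γt ≤ R.u3.γ) (hWeq : R.u3.W = Window R.u3.γ)
    (h : RatesHolderAt D R β) :
    RatesHolderAt D ⟨R.ne1, R.ne2, R.ne3,
      ⟨R.u3.C, Window γt, γt, R.u3.κ, R.u3.EA, R.u3.EB, R.u3.θ, R.u3.C₅, R.u3.Λ, R.u3.C₉, R.u3.ω, R.u3.cr, R.u3.ρ⟩⟩ β :=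
  ratesHolderAt_shrink D R β hγ (hWeq ▸ window_mono hγ) h

/-- … and the (D4) read-out in the record's case. [folklore] -/
theorem readOutAt_shrink_window (D : Datum F N) (u : U3Carriers) {γt : ℝ} (hγ : γt ≤ u.γ) (hWeq : u.W = Window u.γ) (h : ReadOutAt D u) :
    ReadOutAt D ⟨u.C, Window γt, γt, u.κ, u.EA, u.EB, u.θ, u.C₅, u.Λ, u.C₉, u.ω, u.cr, u.ρ⟩ :=
  readOutAt_shrink D u hγ (hWeq ▸ window_mono hγ) h

end Rates

end Summit.QuantumFields.YangMills.BalabanUVNodes.N19RatesAtTuningWindow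

end
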